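/-
Copyright: the b2b-balaban T⁴-continuum CRUX team, row NE7b OWNER lineage `t4-ne7b-p1` (gen 142). Project licence.
-/
import Summits.QuantumFields.BalabanUV.T4Continuum.Spine.NE7b.SupFifthCumulantSingleCuts

/-!
# THE PAIR–TRIPLE CUT OF THE FIFTH CUMULANT, END TO END (SCOPING (d14)(2)(ii), seventh analytic order-five file — the order-5 analogue of (492)).
# Same setting as (546) (mean-centred class observables, decaying crossing forms `B(a_i,a_j) ≤ K∕r_{ij}²⁴`, centred moments `≤ M₂, M₄, M₆`).  ACROSS
# THE CUT `{1,2}|{3,4,5}`: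
#   `|u₅| ≤ (6K + 5M₆ + (M₂+M₄)²∕2 + 3M₂M₄ + 3K(M₂+M₄) + 12M₂√(KM₄))∕min(r₁₃,r₁₄,r₁₅,r₂₃,r₂₄,r₂₅)⁶`:
# (540)'s triangle `|u₅| ≤ |M − P₁₂T₃₄₅| + Σ_9|P||T|`; the straddling covariance by (545); the six CROSSING pairings `≤ K∕r_min⁶` ((491)) against triple
# moments `≤ (M₂+M₄)∕2`; the three inside pairings `≤ M₂` against the straddling third cumulants `E[f₁f₂f_e] = E[f_ef₁f₂]`, bounded by (461) with
# `F_e` FIRST so that both forms `B(a_e,a₁)`, `B(a_e,a₂)` cross the cut: `≤ 4√(KM₄)∕r_min⁶`.  With (546) BOTH cut shapes are typed; the fifteen cuts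
# of (539) follow by relabelling (row NE7b, node U5c; (545) `pair_triple_cut_bound`, (540) `abs_u5_le_pair_cut`, (491), (461), (486), (546) BY NAME;
# [folklore])

Cell `pub-balaban`, sub-cell `t4`, spine estimate NE7b (`T4WeightBudget.RelWeightBound`; the cell's OWN estimate — NOT PRINTED in
[Bałaban 1983–89], NOT PROVED).  Crux-route work under `Spine/NE7b/` by the row OWNER (`t4-ne7b-p1` gen 142, file (547)) under FREEZE
(0)'s crux-prover clause; NOTHING of Bałaban's is named as a Lean object, valued or asserted; no `T4Continuum/Support` leaf typed; no
`def`, no notation (`u₅` WRITTEN OUT); zero `sorry`.  Imports (BY NAME): the OWNER's (546) `…SupFifthCumulantSingleCuts` (`bilinear_pair_split`,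
`sqrt_step`, `abs_expect_triple_le`; through it (545), (540), (491), (461), (486)).

WHAT IS PROVED ([folklore]): THE END **`fifth_cumulant_pair_cut`**; §2 toy.

HONEST (what this is NOT).  The second cut shape; the relabelled fifteen, (539)'s threshold `|u₅| ≤ C₅·t⋆⁴` (with `q = 1∕r`, `r_min⁻⁶ ≤ (max q)⁴`),
the whitened instantiation ((466)'s decay, (505)'s sixth moment) and the kernel letter by (538) are the successor's; the cumulant FORM of `∂⁵W` is
NOT typed; scalar skeleton ((A3), NC-NE7b-α UNRULED); nothing of Bałaban's asserted.  BY-NAME EFFECT ON THE WALL: NONE.  NE7b NOT PRINTED ∕ NOT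
PROVED; spine PROVED 0∕9; rung (B)+1 — FINITE-torus statements; NOT the mass gap, NOT Clay.  HONEST DEPENDENCY: continuum YM on T⁴ ⇐ BetaPertH ∧
nine spine estimates (0∕9 proved); BetaPertH ⇐ (D1) ∧ (D4) ∧ CAP+tail; G-an2-4 gates asym, D1 and NE2∕3∕4.
-/

set_option autoImplicit false

noncomputable section

namespace Summit.QuantumFields.BalabanUV.T4Continuum.NE7b.SupFifthCumulantPairCuts

open MeasureTheory Real Set Function Finset
open scoped BigOperators
open SupTruncationGroupBound (abs_expect_pair_le)
open SupDobrushinThirdCumulant (third_cumulant_le)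
open SupFourthCumulantCutBounds (pairing_abs_le decay_le_min_pow)
open SupFifthCumulantCutAlgebra (abs_u5_le_pair_cut)
open SupFifthCumulantCutBounds (pair_triple_cut_bound)
open SupFifthCumulantSingleCuts (bilinear_pair_split sqrt_step abs_expect_triple_le)

variable {ι : Type} [Fintype ι] [DecidableEq ι]

variable {V : (ι → ℝ) → ℝ} {V₁ : ι → (ι → ℝ) → ℝ} {c : ι → ℝ} {Cw γ : ℝ} {J D : ι → ι → ℝ}
  {P : ι → ((ι → ℝ) → ℝ) → ((ι → ℝ) → ℝ)} {F₁ F₂ F₃ F₄ F₅ : (ι → ℝ) → ℝ} {a₁ a₂ a₃ a₄ a₅ : ι → ℝ}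

/-! ## §1. THE END: the pair–triple cut -/

set_option maxHeartbeats 400000 in
/-- **THE END — THE PAIR–TRIPLE CUT `{1,2}|{3,4,5}` OF THE FIFTH CUMULANT**:
`|u₅| ≤ (6K + 5M₆ + (M₂+M₄)²∕2 + 3M₂M₄ + 3K(M₂+M₄) + 12M₂√(KM₄))∕min(r₁₃,r₁₄,r₁₅,r₂₃,r₂₄,r₂₅)⁶`. [folklore] -/
theorem fifth_cumulant_pair_cut
    (hP : ∀ x F ω, P x F ω = (∫ s, F (update ω x s) * exp (-V (update ω x s))) / ∫ s, exp (-V (update ω x s)))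
    (hV : ∀ x ω, HasDerivAt (fun s => V (update ω x s)) (V₁ x ω) (ω x))
    (hfloor : ∀ x ω s t, c x * (s - t) ^ 2 ≤ (V₁ x (update ω x s) - V₁ x (update ω x t)) * (s - t)) (hc : ∀ x, 0 < c x)
    (hceil : ∀ x ω s t, |V₁ x (update ω x s) - V₁ x (update ω x t)| ≤ Cw * |s - t|)
    (hcross : ∀ x z, z ≠ x → ∀ ω s t, |V₁ x (update ω z s) - V₁ x (update ω z t)| ≤ J x z * |s - t|) (hVc : Continuous V)
    (hV0 : Integrable (fun ω : ι → ℝ => exp (-V ω))) (hV2 : ∀ z, Integrable (fun ω : ι → ℝ => ω z ^ 2 * exp (-V ω)))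
    (hJ : ∀ x z, 0 ≤ J x z) (hJ0 : ∀ x, J x x = 0) (hrow : ∀ x, ∑ z, J x z / c x ≤ γ) (hγ0 : 0 ≤ γ) (hγ1 : γ < 1)
    (hD : ∀ x y, 0 ≤ D x y) (hDC : ∀ x y, (if x = y then (1 : ℝ) else 0) + ∑ z, D x z * (J z y / c z) ≤ D x y)
    (h1 : ∀ z ω s t, |F₁ (update ω z s) - F₁ (update ω z t)| ≤ a₁ z * |s - t|)
    (h2 : ∀ z ω s t, |F₂ (update ω z s) - F₂ (update ω z t)| ≤ a₂ z * |s - t|)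
    (h3 : ∀ z ω s t, |F₃ (update ω z s) - F₃ (update ω z t)| ≤ a₃ z * |s - t|)
    (h4 : ∀ z ω s t, |F₄ (update ω z s) - F₄ (update ω z t)| ≤ a₄ z * |s - t|)
    (h5 : ∀ z ω s t, |F₅ (update ω z s) - F₅ (update ω z t)| ≤ a₅ z * |s - t|)
    {K r13 r14 r15 r23 r24 r25 M₂ M₄ M₆ : ℝ} (hK : 0 ≤ K) (hr13 : 1 ≤ r13) (hr14 : 1 ≤ r14) (hr15 : 1 ≤ r15) (hr23 : 1 ≤ r23) (hr24 : 1 ≤ r24) (hr25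
        : 1 ≤ r25)
    (hB13 : (∑ w, (∑ z, D z w * a₁ z) * (∑ z, D z w * a₃ z) / c w) ≤ K / r13 ^ 24)
    (hB14 : (∑ w, (∑ z, D z w * a₁ z) * (∑ z, D z w * a₄ z) / c w) ≤ K / r14 ^ 24)
    (hB15 : (∑ w, (∑ z, D z w * a₁ z) * (∑ z, D z w * a₅ z) / c w) ≤ K / r15 ^ 24)
    (hB23 : (∑ w, (∑ z, D z w * a₂ z) * (∑ z, D z w * a₃ z) / c w) ≤ K / r23 ^ 24)
    (hB24 : (∑ w, (∑ z, D z w * a₂ z) * (∑ z, D z w * a₄ z) / c w) ≤ K / r24 ^ 24)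
    (hB25 : (∑ w, (∑ z, D z w * a₂ z) * (∑ z, D z w * a₅ z) / c w) ≤ K / r25 ^ 24)
    (hq1 : Integrable (fun ω => (F₁ ω - (∫ ω', F₁ ω' ∂((volume : Measure (ι → ℝ)).tilted fun ω => -V ω))) ^ 4) ((volume : Measure (ι → ℝ)).tilted fun
        ω => -V ω))
    (hq2 : Integrable (fun ω => (F₂ ω - (∫ ω', F₂ ω' ∂((volume : Measure (ι → ℝ)).tilted fun ω => -V ω))) ^ 4) ((volume : Measure (ι → ℝ)).tilted fun
        ω => -V ω))
    (hq3 : Integrable (fun ω => (F₃ ω - (∫ ω', F₃ ω' ∂((volume : Measure (ι → ℝ)).tilted fun ω => -V ω))) ^ 4) ((volume : Measure (ι → ℝ)).tilted fun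
        ω => -V ω))
    (hq4 : Integrable (fun ω => (F₄ ω - (∫ ω', F₄ ω' ∂((volume : Measure (ι → ℝ)).tilted fun ω => -V ω))) ^ 4) ((volume : Measure (ι → ℝ)).tilted fun
        ω => -V ω))
    (hq5 : Integrable (fun ω => (F₅ ω - (∫ ω', F₅ ω' ∂((volume : Measure (ι → ℝ)).tilted fun ω => -V ω))) ^ 4) ((volume : Measure (ι → ℝ)).tilted fun
        ω => -V ω))
    (hs1 : Integrable (fun ω => (F₁ ω - (∫ ω', F₁ ω' ∂((volume : Measure (ι → ℝ)).tilted fun ω => -V ω))) ^ 6) ((volume : Measure (ι → ℝ)).tilted fun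
        ω => -V ω))
    (hs2 : Integrable (fun ω => (F₂ ω - (∫ ω', F₂ ω' ∂((volume : Measure (ι → ℝ)).tilted fun ω => -V ω))) ^ 6) ((volume : Measure (ι → ℝ)).tilted fun
        ω => -V ω))
    (hs3 : Integrable (fun ω => (F₃ ω - (∫ ω', F₃ ω' ∂((volume : Measure (ι → ℝ)).tilted fun ω => -V ω))) ^ 6) ((volume : Measure (ι → ℝ)).tilted fun
        ω => -V ω))
    (hs4 : Integrable (fun ω => (F₄ ω - (∫ ω', F₄ ω' ∂((volume : Measure (ι → ℝ)).tilted fun ω => -V ω))) ^ 6) ((volume : Measure (ι → ℝ)).tilted fun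
        ω => -V ω))
    (hs5 : Integrable (fun ω => (F₅ ω - (∫ ω', F₅ ω' ∂((volume : Measure (ι → ℝ)).tilted fun ω => -V ω))) ^ 6) ((volume : Measure (ι → ℝ)).tilted fun
        ω => -V ω))
    (hM21 : ∫ ω, (F₁ ω - (∫ ω', F₁ ω' ∂((volume : Measure (ι → ℝ)).tilted fun ω => -V ω))) ^ 2 ∂((volume : Measure (ι → ℝ)).tilted fun ω => -V ω) ≤
        M₂)
    (hM22 : ∫ ω, (F₂ ω - (∫ ω', F₂ ω' ∂((volume : Measure (ι → ℝ)).tilted fun ω => -V ω))) ^ 2 ∂((volume : Measure (ι → ℝ)).tilted fun ω => -V ω) ≤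
        M₂)
    (hM23 : ∫ ω, (F₃ ω - (∫ ω', F₃ ω' ∂((volume : Measure (ι → ℝ)).tilted fun ω => -V ω))) ^ 2 ∂((volume : Measure (ι → ℝ)).tilted fun ω => -V ω) ≤
        M₂)
    (hM24 : ∫ ω, (F₄ ω - (∫ ω', F₄ ω' ∂((volume : Measure (ι → ℝ)).tilted fun ω => -V ω))) ^ 2 ∂((volume : Measure (ι → ℝ)).tilted fun ω => -V ω) ≤
        M₂)
    (hM25 : ∫ ω, (F₅ ω - (∫ ω', F₅ ω' ∂((volume : Measure (ι → ℝ)).tilted fun ω => -V ω))) ^ 2 ∂((volume : Measure (ι → ℝ)).tilted fun ω => -V ω) ≤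
        M₂)
    (hM41 : ∫ ω, (F₁ ω - (∫ ω', F₁ ω' ∂((volume : Measure (ι → ℝ)).tilted fun ω => -V ω))) ^ 4 ∂((volume : Measure (ι → ℝ)).tilted fun ω => -V ω) ≤
        M₄)
    (hM42 : ∫ ω, (F₂ ω - (∫ ω', F₂ ω' ∂((volume : Measure (ι → ℝ)).tilted fun ω => -V ω))) ^ 4 ∂((volume : Measure (ι → ℝ)).tilted fun ω => -V ω) ≤
        M₄)
    (hM43 : ∫ ω, (F₃ ω - (∫ ω', F₃ ω' ∂((volume : Measure (ι → ℝ)).tilted fun ω => -V ω))) ^ 4 ∂((volume : Measure (ι → ℝ)).tilted fun ω => -V ω) ≤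
        M₄)
    (hM44 : ∫ ω, (F₄ ω - (∫ ω', F₄ ω' ∂((volume : Measure (ι → ℝ)).tilted fun ω => -V ω))) ^ 4 ∂((volume : Measure (ι → ℝ)).tilted fun ω => -V ω) ≤
        M₄)
    (hM45 : ∫ ω, (F₅ ω - (∫ ω', F₅ ω' ∂((volume : Measure (ι → ℝ)).tilted fun ω => -V ω))) ^ 4 ∂((volume : Measure (ι → ℝ)).tilted fun ω => -V ω) ≤
        M₄)
    (hM61 : ∫ ω, (F₁ ω - (∫ ω', F₁ ω' ∂((volume : Measure (ι → ℝ)).tilted fun ω => -V ω))) ^ 6 ∂((volume : Measure (ι → ℝ)).tilted fun ω => -V ω) ≤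
        M₆)
    (hM62 : ∫ ω, (F₂ ω - (∫ ω', F₂ ω' ∂((volume : Measure (ι → ℝ)).tilted fun ω => -V ω))) ^ 6 ∂((volume : Measure (ι → ℝ)).tilted fun ω => -V ω) ≤
        M₆)
    (hM63 : ∫ ω, (F₃ ω - (∫ ω', F₃ ω' ∂((volume : Measure (ι → ℝ)).tilted fun ω => -V ω))) ^ 6 ∂((volume : Measure (ι → ℝ)).tilted fun ω => -V ω) ≤
        M₆)
    (hM64 : ∫ ω, (F₄ ω - (∫ ω', F₄ ω' ∂((volume : Measure (ι → ℝ)).tilted fun ω => -V ω))) ^ 6 ∂((volume : Measure (ι → ℝ)).tilted fun ω => -V ω) ≤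
        M₆)
    (hM65 : ∫ ω, (F₅ ω - (∫ ω', F₅ ω' ∂((volume : Measure (ι → ℝ)).tilted fun ω => -V ω))) ^ 6 ∂((volume : Measure (ι → ℝ)).tilted fun ω => -V ω) ≤
        M₆) :
    |(∫ ω, (F₁ ω - (∫ ω', F₁ ω' ∂((volume : Measure (ι → ℝ)).tilted fun ω => -V ω))) * (F₂ ω - (∫ ω', F₂ ω' ∂((volume : Measure (ι → ℝ)).tilted fun ω
        => -V ω))) * (F₃ ω - (∫ ω', F₃ ω' ∂((volume : Measure (ι → ℝ)).tilted fun ω => -V ω))) * (F₄ ω - (∫ ω', F₄ ω' ∂((volume : Measure (ι →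
        ℝ)).tilted fun ω => -V ω))) * (F₅ ω - (∫ ω', F₅ ω' ∂((volume : Measure (ι → ℝ)).tilted fun ω => -V ω))) ∂((volume : Measure (ι → ℝ)).tilted
        fun ω => -V ω)) -
        ((∫ ω, (F₁ ω - (∫ ω', F₁ ω' ∂((volume : Measure (ι → ℝ)).tilted fun ω => -V ω))) * (F₂ ω - (∫ ω', F₂ ω' ∂((volume : Measure (ι → ℝ)).tilted
            fun ω => -V ω))) ∂((volume : Measure (ι → ℝ)).tilted fun ω => -V ω)) * (∫ ω, (F₃ ω - (∫ ω', F₃ ω' ∂((volume : Measure (ι → ℝ)).tilted fun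
            ω => -V ω))) * (F₄ ω - (∫ ω', F₄ ω' ∂((volume : Measure (ι → ℝ)).tilted fun ω => -V ω))) * (F₅ ω - (∫ ω', F₅ ω' ∂((volume : Measure (ι →
            ℝ)).tilted fun ω => -V ω))) ∂((volume : Measure (ι → ℝ)).tilted fun ω => -V ω)) +
        (∫ ω, (F₁ ω - (∫ ω', F₁ ω' ∂((volume : Measure (ι → ℝ)).tilted fun ω => -V ω))) * (F₃ ω - (∫ ω', F₃ ω' ∂((volume : Measure (ι → ℝ)).tilted
            fun ω => -V ω))) ∂((volume : Measure (ι → ℝ)).tilted fun ω => -V ω)) * (∫ ω, (F₂ ω - (∫ ω', F₂ ω' ∂((volume : Measure (ι → ℝ)).tilted fun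
            ω => -V ω))) * (F₄ ω - (∫ ω', F₄ ω' ∂((volume : Measure (ι → ℝ)).tilted fun ω => -V ω))) * (F₅ ω - (∫ ω', F₅ ω' ∂((volume : Measure (ι →
            ℝ)).tilted fun ω => -V ω))) ∂((volume : Measure (ι → ℝ)).tilted fun ω => -V ω)) +
        (∫ ω, (F₁ ω - (∫ ω', F₁ ω' ∂((volume : Measure (ι → ℝ)).tilted fun ω => -V ω))) * (F₄ ω - (∫ ω', F₄ ω' ∂((volume : Measure (ι → ℝ)).tilted
            fun ω => -V ω))) ∂((volume : Measure (ι → ℝ)).tilted fun ω => -V ω)) * (∫ ω, (F₂ ω - (∫ ω', F₂ ω' ∂((volume : Measure (ι → ℝ)).tilted fun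
            ω => -V ω))) * (F₃ ω - (∫ ω', F₃ ω' ∂((volume : Measure (ι → ℝ)).tilted fun ω => -V ω))) * (F₅ ω - (∫ ω', F₅ ω' ∂((volume : Measure (ι →
            ℝ)).tilted fun ω => -V ω))) ∂((volume : Measure (ι → ℝ)).tilted fun ω => -V ω)) +
        (∫ ω, (F₁ ω - (∫ ω', F₁ ω' ∂((volume : Measure (ι → ℝ)).tilted fun ω => -V ω))) * (F₅ ω - (∫ ω', F₅ ω' ∂((volume : Measure (ι → ℝ)).tilted
            fun ω => -V ω))) ∂((volume : Measure (ι → ℝ)).tilted fun ω => -V ω)) * (∫ ω, (F₂ ω - (∫ ω', F₂ ω' ∂((volume : Measure (ι → ℝ)).tilted fun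
            ω => -V ω))) * (F₃ ω - (∫ ω', F₃ ω' ∂((volume : Measure (ι → ℝ)).tilted fun ω => -V ω))) * (F₄ ω - (∫ ω', F₄ ω' ∂((volume : Measure (ι →
            ℝ)).tilted fun ω => -V ω))) ∂((volume : Measure (ι → ℝ)).tilted fun ω => -V ω)) +
        (∫ ω, (F₂ ω - (∫ ω', F₂ ω' ∂((volume : Measure (ι → ℝ)).tilted fun ω => -V ω))) * (F₃ ω - (∫ ω', F₃ ω' ∂((volume : Measure (ι → ℝ)).tilted
            fun ω => -V ω))) ∂((volume : Measure (ι → ℝ)).tilted fun ω => -V ω)) * (∫ ω, (F₁ ω - (∫ ω', F₁ ω' ∂((volume : Measure (ι → ℝ)).tilted fun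
            ω => -V ω))) * (F₄ ω - (∫ ω', F₄ ω' ∂((volume : Measure (ι → ℝ)).tilted fun ω => -V ω))) * (F₅ ω - (∫ ω', F₅ ω' ∂((volume : Measure (ι →
            ℝ)).tilted fun ω => -V ω))) ∂((volume : Measure (ι → ℝ)).tilted fun ω => -V ω)) +
        (∫ ω, (F₂ ω - (∫ ω', F₂ ω' ∂((volume : Measure (ι → ℝ)).tilted fun ω => -V ω))) * (F₄ ω - (∫ ω', F₄ ω' ∂((volume : Measure (ι → ℝ)).tilted
            fun ω => -V ω))) ∂((volume : Measure (ι → ℝ)).tilted fun ω => -V ω)) * (∫ ω, (F₁ ω - (∫ ω', F₁ ω' ∂((volume : Measure (ι → ℝ)).tilted fun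
            ω => -V ω))) * (F₃ ω - (∫ ω', F₃ ω' ∂((volume : Measure (ι → ℝ)).tilted fun ω => -V ω))) * (F₅ ω - (∫ ω', F₅ ω' ∂((volume : Measure (ι →
            ℝ)).tilted fun ω => -V ω))) ∂((volume : Measure (ι → ℝ)).tilted fun ω => -V ω)) +
        (∫ ω, (F₂ ω - (∫ ω', F₂ ω' ∂((volume : Measure (ι → ℝ)).tilted fun ω => -V ω))) * (F₅ ω - (∫ ω', F₅ ω' ∂((volume : Measure (ι → ℝ)).tilted
            fun ω => -V ω))) ∂((volume : Measure (ι → ℝ)).tilted fun ω => -V ω)) * (∫ ω, (F₁ ω - (∫ ω', F₁ ω' ∂((volume : Measure (ι → ℝ)).tilted fun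
            ω => -V ω))) * (F₃ ω - (∫ ω', F₃ ω' ∂((volume : Measure (ι → ℝ)).tilted fun ω => -V ω))) * (F₄ ω - (∫ ω', F₄ ω' ∂((volume : Measure (ι →
            ℝ)).tilted fun ω => -V ω))) ∂((volume : Measure (ι → ℝ)).tilted fun ω => -V ω)) +
        (∫ ω, (F₃ ω - (∫ ω', F₃ ω' ∂((volume : Measure (ι → ℝ)).tilted fun ω => -V ω))) * (F₄ ω - (∫ ω', F₄ ω' ∂((volume : Measure (ι → ℝ)).tilted
            fun ω => -V ω))) ∂((volume : Measure (ι → ℝ)).tilted fun ω => -V ω)) * (∫ ω, (F₁ ω - (∫ ω', F₁ ω' ∂((volume : Measure (ι → ℝ)).tilted fun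
            ω => -V ω))) * (F₂ ω - (∫ ω', F₂ ω' ∂((volume : Measure (ι → ℝ)).tilted fun ω => -V ω))) * (F₅ ω - (∫ ω', F₅ ω' ∂((volume : Measure (ι →
            ℝ)).tilted fun ω => -V ω))) ∂((volume : Measure (ι → ℝ)).tilted fun ω => -V ω)) +
        (∫ ω, (F₃ ω - (∫ ω', F₃ ω' ∂((volume : Measure (ι → ℝ)).tilted fun ω => -V ω))) * (F₅ ω - (∫ ω', F₅ ω' ∂((volume : Measure (ι → ℝ)).tilted
            fun ω => -V ω))) ∂((volume : Measure (ι → ℝ)).tilted fun ω => -V ω)) * (∫ ω, (F₁ ω - (∫ ω', F₁ ω' ∂((volume : Measure (ι → ℝ)).tilted fun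
            ω => -V ω))) * (F₂ ω - (∫ ω', F₂ ω' ∂((volume : Measure (ι → ℝ)).tilted fun ω => -V ω))) * (F₄ ω - (∫ ω', F₄ ω' ∂((volume : Measure (ι →
            ℝ)).tilted fun ω => -V ω))) ∂((volume : Measure (ι → ℝ)).tilted fun ω => -V ω)) +
        (∫ ω, (F₄ ω - (∫ ω', F₄ ω' ∂((volume : Measure (ι → ℝ)).tilted fun ω => -V ω))) * (F₅ ω - (∫ ω', F₅ ω' ∂((volume : Measure (ι → ℝ)).tilted
            fun ω => -V ω))) ∂((volume : Measure (ι → ℝ)).tilted fun ω => -V ω)) * (∫ ω, (F₁ ω - (∫ ω', F₁ ω' ∂((volume : Measure (ι → ℝ)).tilted fun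
            ω => -V ω))) * (F₂ ω - (∫ ω', F₂ ω' ∂((volume : Measure (ι → ℝ)).tilted fun ω => -V ω))) * (F₃ ω - (∫ ω', F₃ ω' ∂((volume : Measure (ι →
            ℝ)).tilted fun ω => -V ω))) ∂((volume : Measure (ι → ℝ)).tilted fun ω => -V ω)))| ≤
      (6 * K + 5 * M₆ + (M₂ + M₄) ^ 2 / 2 + 3 * M₂ * M₄ + 3 * K * (M₂ + M₄) + 12 * M₂ * Real.sqrt (K * M₄)) / (min r13 (min r14 (min r15 (min r23
          (min r24 r25))))) ^ 6 := by
  set ν : Measure (ι → ℝ) := ((volume : Measure (ι → ℝ)).tilted fun ω => -V ω) with hν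
  haveI : IsProbabilityMeasure ν := isProbabilityMeasure_tilted hV0
  set rm : ℝ := min r13 (min r14 (min r15 (min r23 (min r24 r25)))) with hrm
  have hrm1 : 1 ≤ rm := le_min hr13 (le_min hr14 (le_min hr15 (le_min hr23 (le_min hr24 hr25))))
  have hrm0 : 0 < rm := by linarith
  have l13 : rm ≤ r13 := min_le_left _ _
  have l14 : rm ≤ r14 := (min_le_right _ _).trans (min_le_left _ _)
  have l15 : rm ≤ r15 := (min_le_right _ _).trans ((min_le_right _ _).trans (min_le_left _ _))
  have l23 : rm ≤ r23 := (min_le_right _ _).trans ((min_le_right _ _).trans ((min_le_right _ _).trans (min_le_left _ _)))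
  have l24 : rm ≤ r24 := (min_le_right _ _).trans ((min_le_right _ _).trans ((min_le_right _ _).trans ((min_le_right _ _).trans (min_le_left _ _))))
  have l25 : rm ≤ r25 := (min_le_right _ _).trans ((min_le_right _ _).trans ((min_le_right _ _).trans ((min_le_right _ _).trans (min_le_right _ _))))
  have hM2nn : 0 ≤ M₂ := le_trans (integral_nonneg fun ω => sq_nonneg _) hM21
  have hM4nn : 0 ≤ M₄ := le_trans (integral_nonneg fun ω => by positivity) hM41
  have hm1 : Measurable fun ω => F₁ ω - (∫ ω', F₁ ω' ∂((volume : Measure (ι → ℝ)).tilted fun ω => -V ω)) := (SupCoordinateLipschitzClass.measurable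
      h1).sub_const _
  have hm2 : Measurable fun ω => F₂ ω - (∫ ω', F₂ ω' ∂((volume : Measure (ι → ℝ)).tilted fun ω => -V ω)) := (SupCoordinateLipschitzClass.measurable
      h2).sub_const _
  have hm3 : Measurable fun ω => F₃ ω - (∫ ω', F₃ ω' ∂((volume : Measure (ι → ℝ)).tilted fun ω => -V ω)) := (SupCoordinateLipschitzClass.measurable
      h3).sub_const _
  have hm4 : Measurable fun ω => F₄ ω - (∫ ω', F₄ ω' ∂((volume : Measure (ι → ℝ)).tilted fun ω => -V ω)) := (SupCoordinateLipschitzClass.measurable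
      h4).sub_const _
  have hm5 : Measurable fun ω => F₅ ω - (∫ ω', F₅ ω' ∂((volume : Measure (ι → ℝ)).tilted fun ω => -V ω)) := (SupCoordinateLipschitzClass.measurable
      h5).sub_const _
  -- (545): the straddling `2|3` covariance
  have hM : |(∫ ω, (F₁ ω - (∫ ω', F₁ ω' ∂((volume : Measure (ι → ℝ)).tilted fun ω => -V ω))) * (F₂ ω - (∫ ω', F₂ ω' ∂((volume : Measure (ι →
      ℝ)).tilted fun ω => -V ω))) * (F₃ ω - (∫ ω', F₃ ω' ∂((volume : Measure (ι → ℝ)).tilted fun ω => -V ω))) * (F₄ ω - (∫ ω', F₄ ω' ∂((volume :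
      Measure (ι → ℝ)).tilted fun ω => -V ω))) * (F₅ ω - (∫ ω', F₅ ω' ∂((volume : Measure (ι → ℝ)).tilted fun ω => -V ω))) ∂((volume : Measure (ι →
      ℝ)).tilted fun ω => -V ω)) - (∫ ω, (F₁ ω - (∫ ω', F₁ ω' ∂((volume : Measure (ι → ℝ)).tilted fun ω => -V ω))) * (F₂ ω - (∫ ω', F₂ ω' ∂((volume :
      Measure (ι → ℝ)).tilted fun ω => -V ω))) ∂((volume : Measure (ι → ℝ)).tilted fun ω => -V ω)) * (∫ ω, (F₃ ω - (∫ ω', F₃ ω' ∂((volume : Measure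
      (ι → ℝ)).tilted fun ω => -V ω))) * (F₄ ω - (∫ ω', F₄ ω' ∂((volume : Measure (ι → ℝ)).tilted fun ω => -V ω))) * (F₅ ω - (∫ ω', F₅ ω' ∂((volume :
      Measure (ι → ℝ)).tilted fun ω => -V ω))) ∂((volume : Measure (ι → ℝ)).tilted fun ω => -V ω))| ≤ (6 * K + 5 * M₆ + (M₂ + M₄) ^ 2 / 2 + 3 * M₂ *
      M₄) / rm ^ 6 :=
    pair_triple_cut_bound hP hV hfloor hc hceil hcross hVc hV0 hV2 hJ hJ0 hrow hγ0 hγ1 hD hDC h1 h2 h3 h4 h5 (∫ ω', F₁ ω' ∂((volume : Measure (ι →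
        ℝ)).tilted fun ω => -V ω)) (∫ ω', F₂ ω' ∂((volume : Measure (ι → ℝ)).tilted fun ω => -V ω)) (∫ ω', F₃ ω' ∂((volume : Measure (ι → ℝ)).tilted
        fun ω => -V ω)) (∫ ω', F₄ ω' ∂((volume : Measure (ι → ℝ)).tilted fun ω => -V ω)) (∫ ω', F₅ ω' ∂((volume : Measure (ι → ℝ)).tilted fun ω => -V
        ω)) hK hr13 hr14 hr15 hr23 hr24 hr25 hB13 hB14 hB15 hB23 hB24 hB25 hq1 hq2 hq3 hq4 hq5 hs1 hs2 hs3 hs4 hs5 hM21 hM22 hM23 hM41 hM42 hM43 hM44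
        hM45 hM61 hM62 hM63 hM64 hM65
  -- (491): the six crossing pairings decay; (546): the far triple moments; (486): the inside pairings
  have hP13 : |(∫ ω, (F₁ ω - (∫ ω', F₁ ω' ∂((volume : Measure (ι → ℝ)).tilted fun ω => -V ω))) * (F₃ ω - (∫ ω', F₃ ω' ∂((volume : Measure (ι →
      ℝ)).tilted fun ω => -V ω))) ∂((volume : Measure (ι → ℝ)).tilted fun ω => -V ω))| ≤ K / rm ^ 6 :=
    (pairing_abs_le hP hV hfloor hc hceil hcross hVc hV0 hV2 hJ hJ0 hrow hγ0 hγ1 hD hDC h1 h3 hB13).trans (decay_le_min_pow hK hrm1 l13)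
  have hP14 : |(∫ ω, (F₁ ω - (∫ ω', F₁ ω' ∂((volume : Measure (ι → ℝ)).tilted fun ω => -V ω))) * (F₄ ω - (∫ ω', F₄ ω' ∂((volume : Measure (ι →
      ℝ)).tilted fun ω => -V ω))) ∂((volume : Measure (ι → ℝ)).tilted fun ω => -V ω))| ≤ K / rm ^ 6 :=
    (pairing_abs_le hP hV hfloor hc hceil hcross hVc hV0 hV2 hJ hJ0 hrow hγ0 hγ1 hD hDC h1 h4 hB14).trans (decay_le_min_pow hK hrm1 l14)
  have hP15 : |(∫ ω, (F₁ ω - (∫ ω', F₁ ω' ∂((volume : Measure (ι → ℝ)).tilted fun ω => -V ω))) * (F₅ ω - (∫ ω', F₅ ω' ∂((volume : Measure (ι →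
      ℝ)).tilted fun ω => -V ω))) ∂((volume : Measure (ι → ℝ)).tilted fun ω => -V ω))| ≤ K / rm ^ 6 :=
    (pairing_abs_le hP hV hfloor hc hceil hcross hVc hV0 hV2 hJ hJ0 hrow hγ0 hγ1 hD hDC h1 h5 hB15).trans (decay_le_min_pow hK hrm1 l15)
  have hP23 : |(∫ ω, (F₂ ω - (∫ ω', F₂ ω' ∂((volume : Measure (ι → ℝ)).tilted fun ω => -V ω))) * (F₃ ω - (∫ ω', F₃ ω' ∂((volume : Measure (ι →
      ℝ)).tilted fun ω => -V ω))) ∂((volume : Measure (ι → ℝ)).tilted fun ω => -V ω))| ≤ K / rm ^ 6 :=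
    (pairing_abs_le hP hV hfloor hc hceil hcross hVc hV0 hV2 hJ hJ0 hrow hγ0 hγ1 hD hDC h2 h3 hB23).trans (decay_le_min_pow hK hrm1 l23)
  have hP24 : |(∫ ω, (F₂ ω - (∫ ω', F₂ ω' ∂((volume : Measure (ι → ℝ)).tilted fun ω => -V ω))) * (F₄ ω - (∫ ω', F₄ ω' ∂((volume : Measure (ι →
      ℝ)).tilted fun ω => -V ω))) ∂((volume : Measure (ι → ℝ)).tilted fun ω => -V ω))| ≤ K / rm ^ 6 :=
    (pairing_abs_le hP hV hfloor hc hceil hcross hVc hV0 hV2 hJ hJ0 hrow hγ0 hγ1 hD hDC h2 h4 hB24).trans (decay_le_min_pow hK hrm1 l24)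
  have hP25 : |(∫ ω, (F₂ ω - (∫ ω', F₂ ω' ∂((volume : Measure (ι → ℝ)).tilted fun ω => -V ω))) * (F₅ ω - (∫ ω', F₅ ω' ∂((volume : Measure (ι →
      ℝ)).tilted fun ω => -V ω))) ∂((volume : Measure (ι → ℝ)).tilted fun ω => -V ω))| ≤ K / rm ^ 6 :=
    (pairing_abs_le hP hV hfloor hc hceil hcross hVc hV0 hV2 hJ hJ0 hrow hγ0 hγ1 hD hDC h2 h5 hB25).trans (decay_le_min_pow hK hrm1 l25)
  have hP34 : |(∫ ω, (F₃ ω - (∫ ω', F₃ ω' ∂((volume : Measure (ι → ℝ)).tilted fun ω => -V ω))) * (F₄ ω - (∫ ω', F₄ ω' ∂((volume : Measure (ι →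
      ℝ)).tilted fun ω => -V ω))) ∂((volume : Measure (ι → ℝ)).tilted fun ω => -V ω))| ≤ M₂ :=
    (abs_expect_pair_le (μ := ν) hm3 hm4 hq3 hq4).trans (by linarith [hM23, hM24])
  have hP35 : |(∫ ω, (F₃ ω - (∫ ω', F₃ ω' ∂((volume : Measure (ι → ℝ)).tilted fun ω => -V ω))) * (F₅ ω - (∫ ω', F₅ ω' ∂((volume : Measure (ι →
      ℝ)).tilted fun ω => -V ω))) ∂((volume : Measure (ι → ℝ)).tilted fun ω => -V ω))| ≤ M₂ :=
    (abs_expect_pair_le (μ := ν) hm3 hm5 hq3 hq5).trans (by linarith [hM23, hM25])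
  have hP45 : |(∫ ω, (F₄ ω - (∫ ω', F₄ ω' ∂((volume : Measure (ι → ℝ)).tilted fun ω => -V ω))) * (F₅ ω - (∫ ω', F₅ ω' ∂((volume : Measure (ι →
      ℝ)).tilted fun ω => -V ω))) ∂((volume : Measure (ι → ℝ)).tilted fun ω => -V ω))| ≤ M₂ :=
    (abs_expect_pair_le (μ := ν) hm4 hm5 hq4 hq5).trans (by linarith [hM24, hM25])
  have hT245 : |(∫ ω, (F₂ ω - (∫ ω', F₂ ω' ∂((volume : Measure (ι → ℝ)).tilted fun ω => -V ω))) * (F₄ ω - (∫ ω', F₄ ω' ∂((volume : Measure (ι →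
      ℝ)).tilted fun ω => -V ω))) * (F₅ ω - (∫ ω', F₅ ω' ∂((volume : Measure (ι → ℝ)).tilted fun ω => -V ω))) ∂((volume : Measure (ι → ℝ)).tilted fun
      ω => -V ω))| ≤ (M₂ + M₄) / 2 :=
    (abs_expect_triple_le (μ := ν) hm2 hm4 hm5 hq2 hq4 hq5).trans (by linarith [hM22, hM44, hM45])
  have hT235 : |(∫ ω, (F₂ ω - (∫ ω', F₂ ω' ∂((volume : Measure (ι → ℝ)).tilted fun ω => -V ω))) * (F₃ ω - (∫ ω', F₃ ω' ∂((volume : Measure (ι →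
      ℝ)).tilted fun ω => -V ω))) * (F₅ ω - (∫ ω', F₅ ω' ∂((volume : Measure (ι → ℝ)).tilted fun ω => -V ω))) ∂((volume : Measure (ι → ℝ)).tilted fun
      ω => -V ω))| ≤ (M₂ + M₄) / 2 :=
    (abs_expect_triple_le (μ := ν) hm2 hm3 hm5 hq2 hq3 hq5).trans (by linarith [hM22, hM43, hM45])
  have hT234 : |(∫ ω, (F₂ ω - (∫ ω', F₂ ω' ∂((volume : Measure (ι → ℝ)).tilted fun ω => -V ω))) * (F₃ ω - (∫ ω', F₃ ω' ∂((volume : Measure (ι →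
      ℝ)).tilted fun ω => -V ω))) * (F₄ ω - (∫ ω', F₄ ω' ∂((volume : Measure (ι → ℝ)).tilted fun ω => -V ω))) ∂((volume : Measure (ι → ℝ)).tilted fun
      ω => -V ω))| ≤ (M₂ + M₄) / 2 :=
    (abs_expect_triple_le (μ := ν) hm2 hm3 hm4 hq2 hq3 hq4).trans (by linarith [hM22, hM43, hM44])
  have hT145 : |(∫ ω, (F₁ ω - (∫ ω', F₁ ω' ∂((volume : Measure (ι → ℝ)).tilted fun ω => -V ω))) * (F₄ ω - (∫ ω', F₄ ω' ∂((volume : Measure (ι →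
      ℝ)).tilted fun ω => -V ω))) * (F₅ ω - (∫ ω', F₅ ω' ∂((volume : Measure (ι → ℝ)).tilted fun ω => -V ω))) ∂((volume : Measure (ι → ℝ)).tilted fun
      ω => -V ω))| ≤ (M₂ + M₄) / 2 :=
    (abs_expect_triple_le (μ := ν) hm1 hm4 hm5 hq1 hq4 hq5).trans (by linarith [hM21, hM44, hM45])
  have hT135 : |(∫ ω, (F₁ ω - (∫ ω', F₁ ω' ∂((volume : Measure (ι → ℝ)).tilted fun ω => -V ω))) * (F₃ ω - (∫ ω', F₃ ω' ∂((volume : Measure (ι →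
      ℝ)).tilted fun ω => -V ω))) * (F₅ ω - (∫ ω', F₅ ω' ∂((volume : Measure (ι → ℝ)).tilted fun ω => -V ω))) ∂((volume : Measure (ι → ℝ)).tilted fun
      ω => -V ω))| ≤ (M₂ + M₄) / 2 :=
    (abs_expect_triple_le (μ := ν) hm1 hm3 hm5 hq1 hq3 hq5).trans (by linarith [hM21, hM43, hM45])
  have hT134 : |(∫ ω, (F₁ ω - (∫ ω', F₁ ω' ∂((volume : Measure (ι → ℝ)).tilted fun ω => -V ω))) * (F₃ ω - (∫ ω', F₃ ω' ∂((volume : Measure (ι →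
      ℝ)).tilted fun ω => -V ω))) * (F₄ ω - (∫ ω', F₄ ω' ∂((volume : Measure (ι → ℝ)).tilted fun ω => -V ω))) ∂((volume : Measure (ι → ℝ)).tilted fun
      ω => -V ω))| ≤ (M₂ + M₄) / 2 :=
    (abs_expect_triple_le (μ := ν) hm1 hm3 hm4 hq1 hq3 hq4).trans (by linarith [hM21, hM43, hM44])
  -- (461): the three straddling third cumulants `E[f₁f₂f_e] = E[f_ef₁f₂]` decay across the cut
  have hT125 : |(∫ ω, (F₁ ω - (∫ ω', F₁ ω' ∂((volume : Measure (ι → ℝ)).tilted fun ω => -V ω))) * (F₂ ω - (∫ ω', F₂ ω' ∂((volume : Measure (ι →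
      ℝ)).tilted fun ω => -V ω))) * (F₅ ω - (∫ ω', F₅ ω' ∂((volume : Measure (ι → ℝ)).tilted fun ω => -V ω))) ∂((volume : Measure (ι → ℝ)).tilted fun
      ω => -V ω))| ≤ 4 * Real.sqrt (K * M₄) / rm ^ 6 := by
    have ecomm : (∫ ω, (F₁ ω - (∫ ω', F₁ ω' ∂((volume : Measure (ι → ℝ)).tilted fun ω => -V ω))) * (F₂ ω - (∫ ω', F₂ ω' ∂((volume : Measure (ι →
        ℝ)).tilted fun ω => -V ω))) * (F₅ ω - (∫ ω', F₅ ω' ∂((volume : Measure (ι → ℝ)).tilted fun ω => -V ω))) ∂((volume : Measure (ι → ℝ)).tilted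
        fun ω => -V ω)) = ∫ ω, (F₅ ω - (∫ ω', F₅ ω' ∂((volume : Measure (ι → ℝ)).tilted fun ω => -V ω))) * (F₁ ω - (∫ ω', F₁ ω' ∂((volume : Measure
        (ι → ℝ)).tilted fun ω => -V ω))) * (F₂ ω - (∫ ω', F₂ ω' ∂((volume : Measure (ι → ℝ)).tilted fun ω => -V ω))) ∂((volume : Measure (ι →
        ℝ)).tilted fun ω => -V ω) :=
      integral_congr_ae (ae_of_all _ fun ω => by ring)
    rw [ecomm]
    have h3 := third_cumulant_le hP hV hfloor hc hceil hcross hVc hV0 hV2 hJ hJ0 hrow hγ0 hγ1 hD hDC h5 h1 h2 (∫ ω', F₁ ω' ∂((volume : Measure (ι →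
        ℝ)).tilted fun ω => -V ω)) (∫ ω', F₂ ω' ∂((volume : Measure (ι → ℝ)).tilted fun ω => -V ω)) hq5 hq1 hq2 hM45 hM41 hM42
    have hS : (∑ w, (∑ z, D z w * a₅ z) * ((∑ z, D z w * a₁ z) + ∑ z, D z w * a₂ z) / c w) ≤ 2 * K / rm ^ 24 := by
      rw [bilinear_pair_split]
      have c1 : (∑ w, (∑ z, D z w * a₅ z) * (∑ z, D z w * a₁ z) / c w) = (∑ w, (∑ z, D z w * a₁ z) * (∑ z, D z w * a₅ z) / c w) := Finset.sum_congr
          rfl fun w _ => by ring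
      have c2 : (∑ w, (∑ z, D z w * a₅ z) * (∑ z, D z w * a₂ z) / c w) = (∑ w, (∑ z, D z w * a₂ z) * (∑ z, D z w * a₅ z) / c w) := Finset.sum_congr
          rfl fun w _ => by ring
      rw [c1, c2]
      have e1 := div_le_div_of_nonneg_left hK (by positivity : (0 : ℝ) < rm ^ 24) (pow_le_pow_left₀ hrm0.le l15 24)
      have e2 := div_le_div_of_nonneg_left hK (by positivity : (0 : ℝ) < rm ^ 24) (pow_le_pow_left₀ hrm0.le l25 24)
      linarith [hB15.trans e1, hB25.trans e2, show 2 * K / rm ^ 24 = K / rm ^ 24 + K / rm ^ 24 from by ring]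
    exact h3.trans (sqrt_step hK hM4nn hrm1 hS)
  have hT124 : |(∫ ω, (F₁ ω - (∫ ω', F₁ ω' ∂((volume : Measure (ι → ℝ)).tilted fun ω => -V ω))) * (F₂ ω - (∫ ω', F₂ ω' ∂((volume : Measure (ι →
      ℝ)).tilted fun ω => -V ω))) * (F₄ ω - (∫ ω', F₄ ω' ∂((volume : Measure (ι → ℝ)).tilted fun ω => -V ω))) ∂((volume : Measure (ι → ℝ)).tilted fun
      ω => -V ω))| ≤ 4 * Real.sqrt (K * M₄) / rm ^ 6 := by
    have ecomm : (∫ ω, (F₁ ω - (∫ ω', F₁ ω' ∂((volume : Measure (ι → ℝ)).tilted fun ω => -V ω))) * (F₂ ω - (∫ ω', F₂ ω' ∂((volume : Measure (ι →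
        ℝ)).tilted fun ω => -V ω))) * (F₄ ω - (∫ ω', F₄ ω' ∂((volume : Measure (ι → ℝ)).tilted fun ω => -V ω))) ∂((volume : Measure (ι → ℝ)).tilted
        fun ω => -V ω)) = ∫ ω, (F₄ ω - (∫ ω', F₄ ω' ∂((volume : Measure (ι → ℝ)).tilted fun ω => -V ω))) * (F₁ ω - (∫ ω', F₁ ω' ∂((volume : Measure
        (ι → ℝ)).tilted fun ω => -V ω))) * (F₂ ω - (∫ ω', F₂ ω' ∂((volume : Measure (ι → ℝ)).tilted fun ω => -V ω))) ∂((volume : Measure (ι →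
        ℝ)).tilted fun ω => -V ω) :=
      integral_congr_ae (ae_of_all _ fun ω => by ring)
    rw [ecomm]
    have h3 := third_cumulant_le hP hV hfloor hc hceil hcross hVc hV0 hV2 hJ hJ0 hrow hγ0 hγ1 hD hDC h4 h1 h2 (∫ ω', F₁ ω' ∂((volume : Measure (ι →
        ℝ)).tilted fun ω => -V ω)) (∫ ω', F₂ ω' ∂((volume : Measure (ι → ℝ)).tilted fun ω => -V ω)) hq4 hq1 hq2 hM44 hM41 hM42
    have hS : (∑ w, (∑ z, D z w * a₄ z) * ((∑ z, D z w * a₁ z) + ∑ z, D z w * a₂ z) / c w) ≤ 2 * K / rm ^ 24 := by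
      rw [bilinear_pair_split]
      have c1 : (∑ w, (∑ z, D z w * a₄ z) * (∑ z, D z w * a₁ z) / c w) = (∑ w, (∑ z, D z w * a₁ z) * (∑ z, D z w * a₄ z) / c w) := Finset.sum_congr
          rfl fun w _ => by ring
      have c2 : (∑ w, (∑ z, D z w * a₄ z) * (∑ z, D z w * a₂ z) / c w) = (∑ w, (∑ z, D z w * a₂ z) * (∑ z, D z w * a₄ z) / c w) := Finset.sum_congr
          rfl fun w _ => by ring
      rw [c1, c2]
      have e1 := div_le_div_of_nonneg_left hK (by positivity : (0 : ℝ) < rm ^ 24) (pow_le_pow_left₀ hrm0.le l14 24)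
      have e2 := div_le_div_of_nonneg_left hK (by positivity : (0 : ℝ) < rm ^ 24) (pow_le_pow_left₀ hrm0.le l24 24)
      linarith [hB14.trans e1, hB24.trans e2, show 2 * K / rm ^ 24 = K / rm ^ 24 + K / rm ^ 24 from by ring]
    exact h3.trans (sqrt_step hK hM4nn hrm1 hS)
  have hT123 : |(∫ ω, (F₁ ω - (∫ ω', F₁ ω' ∂((volume : Measure (ι → ℝ)).tilted fun ω => -V ω))) * (F₂ ω - (∫ ω', F₂ ω' ∂((volume : Measure (ι →
      ℝ)).tilted fun ω => -V ω))) * (F₃ ω - (∫ ω', F₃ ω' ∂((volume : Measure (ι → ℝ)).tilted fun ω => -V ω))) ∂((volume : Measure (ι → ℝ)).tilted fun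
      ω => -V ω))| ≤ 4 * Real.sqrt (K * M₄) / rm ^ 6 := by
    have ecomm : (∫ ω, (F₁ ω - (∫ ω', F₁ ω' ∂((volume : Measure (ι → ℝ)).tilted fun ω => -V ω))) * (F₂ ω - (∫ ω', F₂ ω' ∂((volume : Measure (ι →
        ℝ)).tilted fun ω => -V ω))) * (F₃ ω - (∫ ω', F₃ ω' ∂((volume : Measure (ι → ℝ)).tilted fun ω => -V ω))) ∂((volume : Measure (ι → ℝ)).tilted
        fun ω => -V ω)) = ∫ ω, (F₃ ω - (∫ ω', F₃ ω' ∂((volume : Measure (ι → ℝ)).tilted fun ω => -V ω))) * (F₁ ω - (∫ ω', F₁ ω' ∂((volume : Measure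
        (ι → ℝ)).tilted fun ω => -V ω))) * (F₂ ω - (∫ ω', F₂ ω' ∂((volume : Measure (ι → ℝ)).tilted fun ω => -V ω))) ∂((volume : Measure (ι →
        ℝ)).tilted fun ω => -V ω) :=
      integral_congr_ae (ae_of_all _ fun ω => by ring)
    rw [ecomm]
    have h3 := third_cumulant_le hP hV hfloor hc hceil hcross hVc hV0 hV2 hJ hJ0 hrow hγ0 hγ1 hD hDC h3 h1 h2 (∫ ω', F₁ ω' ∂((volume : Measure (ι →
        ℝ)).tilted fun ω => -V ω)) (∫ ω', F₂ ω' ∂((volume : Measure (ι → ℝ)).tilted fun ω => -V ω)) hq3 hq1 hq2 hM43 hM41 hM42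
    have hS : (∑ w, (∑ z, D z w * a₃ z) * ((∑ z, D z w * a₁ z) + ∑ z, D z w * a₂ z) / c w) ≤ 2 * K / rm ^ 24 := by
      rw [bilinear_pair_split]
      have c1 : (∑ w, (∑ z, D z w * a₃ z) * (∑ z, D z w * a₁ z) / c w) = (∑ w, (∑ z, D z w * a₁ z) * (∑ z, D z w * a₃ z) / c w) := Finset.sum_congr
          rfl fun w _ => by ring
      have c2 : (∑ w, (∑ z, D z w * a₃ z) * (∑ z, D z w * a₂ z) / c w) = (∑ w, (∑ z, D z w * a₂ z) * (∑ z, D z w * a₃ z) / c w) := Finset.sum_congr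
          rfl fun w _ => by ring
      rw [c1, c2]
      have e1 := div_le_div_of_nonneg_left hK (by positivity : (0 : ℝ) < rm ^ 24) (pow_le_pow_left₀ hrm0.le l13 24)
      have e2 := div_le_div_of_nonneg_left hK (by positivity : (0 : ℝ) < rm ^ 24) (pow_le_pow_left₀ hrm0.le l23 24)
      linarith [hB13.trans e1, hB23.trans e2, show 2 * K / rm ^ 24 = K / rm ^ 24 + K / rm ^ 24 from by ring]
    exact h3.trans (sqrt_step hK hM4nn hrm1 hS)
  -- the nine products and the assembly by (540)
  have hKr : 0 ≤ K / rm ^ 6 := by positivity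
  have etot : (6 * K + 5 * M₆ + (M₂ + M₄) ^ 2 / 2 + 3 * M₂ * M₄ + 3 * K * (M₂ + M₄) + 12 * M₂ * Real.sqrt (K * M₄)) / rm ^ 6 = (6 * K + 5 * M₆ + (M₂
      + M₄) ^ 2 / 2 + 3 * M₂ * M₄) / rm ^ 6 + 6 * (K / rm ^ 6 * ((M₂ + M₄) / 2)) + 3 * (M₂ * (4 * Real.sqrt (K * M₄) / rm ^ 6)) := by ring
  rw [etot]
  refine abs_u5_le_pair_cut.trans ?_
  linarith [hM, mul_le_mul hP13 hT245 (abs_nonneg _) hKr, mul_le_mul hP14 hT235 (abs_nonneg _) hKr, mul_le_mul hP15 hT234 (abs_nonneg _) hKr,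
      mul_le_mul hP23 hT145 (abs_nonneg _) hKr, mul_le_mul hP24 hT135 (abs_nonneg _) hKr, mul_le_mul hP25 hT134 (abs_nonneg _) hKr, mul_le_mul hP34
      hT125 (abs_nonneg _) hM2nn, mul_le_mul hP35 hT124 (abs_nonneg _) hM2nn, mul_le_mul hP45 hT123 (abs_nonneg _) hM2nn]

/-! ## §2. Toy -/

/-- Toy (the least crossing weight of six unit weights is `1`). -/
example : min (1 : ℝ) (min 1 (min 1 (min 1 (min 1 1)))) = 1 := by norm_num

end Summit.QuantumFields.BalabanUV.T4Continuum.NE7b.SupFifthCumulantPairCuts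

end
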